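import Summits.MatrixMultiplication.OmegaCensus.TriangleTorusShearedDefect

/-!
# The amortised one-sided imbalance bound `54·Δ ≤ 36n + 18` on a punctured sheared torus (kernel)

ω-census `pub-omega`, family (b3), seat pub-omega-group gen 35.  Framing: lottery ticket; floor = certified bounds/negative
ranges.  VALUE: the constant `8/9` of `TriangleTorusShearedDefect.imbalance_le_sharp` (`54·Δ ≤ 48n − 24`) improved to `2/3`
(`54·Δ ≤ 36n + 18`, i.e. `Δ ≤ (2n + 1)/3`) by a residue-aware amortisation of the cell weights of the exact defect identity
`imbalance_eq_defect`; NOT progress on ω.  This is item (i) of HOME/pub-omega-group-g34/HANDOFF.md 'What is left' (one-sided,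
which is all the cube-law census uses), and `2/3` is the exact one-column envelope (RESULTS-g34 §2: the consistent extremal
hole-column word `a b dD b dD … b a`).  Consequence (sequel `ThreeSetTilingPartThreeSix`): a part of size `3` in a cube form over ANY
finite abelian `A` forces `|A| ≤ 6·ord(w′ − w) + 4` (was `|A| + 3 ≤ 8·ord`).

* `flags_of_up_left` — if cell `j` of column `c` is covered from the left (`up (c−1) j`), the covering axiom at
  `(c−1, j)` and `(c−1, j+1)` pins four neighbouring flags.
* `cell_weight_nonneg_one_of_not_up` — for the period rotation `ρ` (`t = 1`), a cell of relative height `≡ 1 (mod 3)`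
  NOT covered from the left has weight `≥ 0`.
* **`block_weight_lower_one`** — for `t = 1`, three consecutive cells whose middle one has relative height `≡ 1 (mod 3)`
  weigh `≥ −108` together (the `−72` of an `a`-cell is paid for by its two neighbours, which are then forced to be of the
  types `plain / D` below and `plain / d` above, of weights `−18 / +36`).
* **`imbalance_le_two_thirds`** — `54·(#up − #down) ≤ 36n + 18` (`3 ∤ n`, `2 ≤ n`, `1 ≤ a`, column `0` has a hole).
-/

namespace Summit.MatrixMultiplication.OmegaCensus.TriangleTorus

open Finset

/-- Splitting a sum over `range (3q)` into `q` blocks of three consecutive terms. [folklore] -/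
theorem sum_range_three_mul (f : ℕ → ℤ) (q : ℕ) :
    ∑ i ∈ range (3 * q), f i = ∑ b ∈ range q, (f (3 * b) + f (3 * b + 1) + f (3 * b + 2)) := by
  induction q with
  | zero => simp
  | succ q ih =>
    rw [show 3 * (q + 1) = 3 * q + 2 + 1 by ring, sum_range_succ, sum_range_succ, sum_range_succ, ih, sum_range_succ]
    ring

namespace ShearedFactor

open TriangleFactor (trot trot_ne_zero)

variable {n a : ℕ} {s : ℤ}

/-- If cell `j` of column `c` is covered from the left (it lies in the up-tile anchored at `(c−1, j)`), then the cells
`j − 1`, `j + 1` of column `c` are not covered from the left, cell `j` is not the anchor of a down-tile and cell `j + 1` is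
not the anchor of a down-tile (covering axiom at `(c−1, j)` and `(c−1, j+1)`). [folklore] -/
theorem flags_of_up_left (T : ShearedFactor n a s) (c j : ℤ) (hu : T.up (c - 1) j = true) :
    T.up (c - 1) (j - 1) = false ∧ T.dn c j = false ∧ T.up (c - 1) (j + 1) = false ∧ T.dn c (j + 1) = false := by
  obtain ⟨-, h1, -, -, -, -, -, -⟩ := six_cases (T.cover (c - 1) j)
  obtain ⟨-, hb, -, hd, -⟩ := h1 hu
  obtain ⟨-, -, -, h3, -, -, -, -⟩ := six_cases (T.cover (c - 1) (j + 1))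
  rw [add_sub_cancel_right] at h3
  obtain ⟨ha, -, -, hd', -⟩ := h3 hu
  rw [sub_add_cancel] at hd hd'
  exact ⟨hb, hd, ha, hd'⟩

/-- For `t = 1`, a cell of relative height `≡ 1 (mod 3)` that is not covered from the left has weight `≥ 0`
(it is a plain cell, weight `36`, or a cell of a down-domino, weight `0`). [folklore] -/
theorem cell_weight_nonneg_one_of_not_up (T : ShearedFactor n a s) (c j₀ j : ℤ) (hres : ((j - j₀ : ℤ) : ZMod 3) = 1)
    (hu : T.up (c - 1) j = false) : 0 ≤ dfun 1 (hol (hexLoop c j₀)).v (T.inPiece c j).sum := by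
  by_cases hd : T.dn c j = true
  · -- then `dn c (j+1) = false` by the covering axiom at `(c, j)`
    obtain ⟨-, -, -, -, h4, -, -, -⟩ := six_cases (T.cover c j)
    obtain ⟨-, -, -, -, hd'⟩ := h4 hd
    unfold inPiece fin0 fin1
    simp only [hu, hd, hd', if_true, Bool.false_eq_true, if_false, List.cons_append, List.nil_append, List.sum_cons,
      List.sum_nil, add_zero, hexLoop, dfun, sD, sV, sH, tw_eq]
    push_cast at *
    revert hres
    generalize (c : ZMod 3) = x
    generalize (j : ZMod 3) = y
    generalize (j₀ : ZMod 3) = z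
    revert x y z
    decide
  · have hd₀ : T.dn c j = false := by simpa using hd
    unfold inPiece fin0 fin1
    simp only [hu, hd₀, Bool.false_eq_true, if_false]
    split_ifs <;>
    · simp only [List.cons_append, List.nil_append, List.sum_cons, List.sum_nil, add_zero, hexLoop, dfun, sD, sV, sH,
        tw_eq]
      push_cast at *
      revert hres
      generalize (c : ZMod 3) = x
      generalize (j : ZMod 3) = y
      generalize (j₀ : ZMod 3) = z
      revert x y z
      decide

/-- **Block lemma** (`t = 1`).  Three consecutive cells `j, j+1, j+2` of column `c` whose middle cell has relative height
`j + 1 − j₀ ≡ 1 (mod 3)` have total weight `≥ −108`. [folklore] -/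
theorem block_weight_lower_one (T : ShearedFactor n a s) (c j₀ j : ℤ) (hres : ((j + 1 - j₀ : ℤ) : ZMod 3) = 1) :
    -108 ≤ dfun 1 (hol (hexLoop c j₀)).v (T.inPiece c j).sum + dfun 1 (hol (hexLoop c j₀)).v (T.inPiece c (j + 1)).sum +
      dfun 1 (hol (hexLoop c j₀)).v (T.inPiece c (j + 2)).sum := by
  by_cases hu : T.up (c - 1) (j + 1) = true
  · -- the middle cell is covered from the left: its neighbours are pinned
    obtain ⟨h1, h2, h3, h4⟩ := T.flags_of_up_left c (j + 1) hu
    rw [add_sub_cancel_right] at h1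
    rw [show j + 1 + 1 = j + 2 by ring] at h3 h4
    unfold inPiece fin0 fin1
    simp only [h1, h2, h3, h4, hu, if_true, Bool.false_eq_true, if_false]
    split_ifs <;>
    · simp only [List.cons_append, List.nil_append, List.sum_cons, List.sum_nil, add_zero, hexLoop, dfun, sD, sV, sH,
        tw_eq]
      push_cast at *
      revert hres
      generalize (c : ZMod 3) = x
      generalize (j : ZMod 3) = y
      generalize (j₀ : ZMod 3) = z
      revert x y z
      decide
  · have hu₀ : T.up (c - 1) (j + 1) = false := by simpa using hu
    have hmid := T.cell_weight_nonneg_one_of_not_up c j₀ (j + 1) hres hu₀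
    have hlo := T.cell_weight_lower_one c j₀ j
    have hhi := T.cell_weight_lower_one c j₀ (j + 2)
    have e1 : ((j - j₀ : ℤ) : ZMod 3) ≠ 1 := by
      intro h
      push_cast at hres h
      have : ((j : ZMod 3) + 1 - j₀) - (j - j₀) = 1 - 1 := by rw [hres, h]
      revert this
      ring_nf
      decide
    have e2 : ((j + 2 - j₀ : ℤ) : ZMod 3) ≠ 1 := by
      intro h
      push_cast at hres h
      have : ((j : ZMod 3) + 2 - j₀) - (j + 1 - j₀) = 1 - 1 := by rw [hres, h]
      revert this
      ring_nf
      decide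
    rw [if_neg e1] at hlo
    rw [if_neg e2] at hhi
    linarith

/-- **Amortised one-sided imbalance bound.**  If column `0` has a hole (`3 ∤ n`, `2 ≤ n`, `1 ≤ a`):
`54·(#up − #down) ≤ 36n + 18`, i.e. `#up − #down ≤ (2n + 1)/3`. [folklore] -/
theorem imbalance_le_two_thirds (T : ShearedFactor n a s) (h3 : ¬ 3 ∣ n) (hn : 2 ≤ n) (ha : 1 ≤ a) (j₀ : ℤ)
    (hc : T.hole 0 j₀ = true) : 54 * (T.upCount - T.dnCount) ≤ 36 * n + 18 := by
  rw [T.imbalance_eq_defect h3 (by omega) ha j₀ hc]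
  have ht : trot n = 1 ∨ trot n = 2 := by
    have hne := trot_ne_zero h3
    generalize trot n = t at hne ⊢
    revert t; decide
  rcases ht with ht | ht
  · -- `t = 1`: `C = 36`; `n = 3q + 2`; blocks of three cells weigh `≥ −108`, the two top cells `≥ −36 − 72`
    rw [ht, defect_const_one]
    have hdvd : (3 : ℤ) ∣ -(n : ℤ) - 1 := by
      refine (ZMod.intCast_zmod_eq_zero_iff_dvd _ 3).1 ?_
      have h := ht
      unfold TriangleFactor.trot at h
      push_cast at h ⊢
      rw [h]
      decide
    obtain ⟨q, hq⟩ : ∃ q : ℕ, n = 3 * q + 2 := ⟨n / 3, by omega⟩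
    set f : ℕ → ℤ := fun i => dfun 1 (hol (hexLoop 0 j₀)).v (T.inPiece 0 (j₀ + (i : ℕ))).sum with hf
    have hsplit : ∑ i ∈ range n, f i =
        ∑ b ∈ range q, (f (3 * b) + f (3 * b + 1) + f (3 * b + 2)) + f (3 * q) + f (3 * q + 1) := by
      rw [hq, sum_range_succ, sum_range_succ, sum_range_three_mul]
    have h3z : (3 : ZMod 3) = 0 := by decide
    have ef : ∀ b r : ℕ, f (3 * b + r) = dfun 1 (hol (hexLoop 0 j₀)).v (T.inPiece 0 (j₀ + 3 * b + r)).sum := by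
      intro b r; simp [hf, add_assoc]
    have ef0 : ∀ b : ℕ, f (3 * b) = dfun 1 (hol (hexLoop 0 j₀)).v (T.inPiece 0 (j₀ + 3 * b)).sum := by
      intro b; simp [hf]
    have hblock : ∀ b ∈ range q, (-108 : ℤ) ≤ f (3 * b) + f (3 * b + 1) + f (3 * b + 2) := by
      intro b _
      have h := T.block_weight_lower_one 0 j₀ (j₀ + 3 * b) (by
        push_cast
        rw [show (j₀ : ZMod 3) + 3 * b + 1 - j₀ = 3 * b + 1 by ring, h3z, zero_mul, zero_add])
      rw [ef0 b, ef b 1, ef b 2]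
      push_cast
      exact h
    have htail₀ : (-36 : ℤ) ≤ f (3 * q) := by
      have h := T.cell_weight_lower_one 0 j₀ (j₀ + 3 * q)
      have e : ((j₀ + 3 * q - j₀ : ℤ) : ZMod 3) ≠ 1 := by
        intro h
        push_cast at h
        rw [show (j₀ : ZMod 3) + 3 * q - j₀ = 3 * q by ring, h3z, zero_mul] at h
        exact absurd h (by decide)
      rw [if_neg e] at h
      rw [ef0 q]
      exact h
    have htail₁ : (-72 : ℤ) ≤ f (3 * q + 1) := by
      have h := T.cell_weight_lower_one 0 j₀ (j₀ + 3 * q + 1)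
      rw [ef q 1]
      push_cast
      split_ifs at h <;> linarith
    have hle := Finset.sum_le_sum hblock
    rw [sum_const, card_range, nsmul_eq_mul] at hle
    have hq' : (n : ℤ) = 3 * q + 2 := by exact_mod_cast hq
    have htot : -(36 * (n : ℤ) + 36) ≤ ∑ i ∈ range n, f i := by rw [hsplit]; nlinarith
    simp only [hf] at htot
    linarith
  · -- `t = 2`: `C = −18`, all weights `≥ −36`
    rw [ht, defect_const_two]
    have hcell : ∀ i ∈ range n, (-36 : ℤ) ≤ dfun 2 (hol (hexLoop 0 j₀)).v (T.inPiece 0 (j₀ + i)).sum :=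
      fun i _ => T.cell_weight_lower_two 0 j₀ (j₀ + i)
    have hle := Finset.sum_le_sum hcell
    rw [sum_const, card_range, nsmul_eq_mul] at hle
    linarith

end ShearedFactor

end Summit.MatrixMultiplication.OmegaCensus.TriangleTorus
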